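import Summits.FinalStateConjecture.FinalStateConjecture.Theses.ZeroEnergyKerrOrBomb
import Summits.FinalStateConjecture.FinalStateConjecture.Theorems.ZeroEnergyRigidity.Negative.MinkowskiNoHorizon
import Summits.FinalStateConjecture.FinalStateConjecture.Theorems.ZeroEnergyRigidity.Negative.MinkowskiIPlusRegular
import Literature.Geometry.Lorentzian.StationaryBlackHoleUniquenessProofs

/-!
# `HawkingExtensionIsKerr` (crux `stmt-FinalStateConjecture-17840`) is FALSE without
# `IsConnected 𝓑.horizon`: the Minkowski presentation passes every other hypothesis

Negative-lane load-bearing analysis for the crux `HawkingExtensionIsKerr` (the dock of route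
`ZeroEnergyKerrOrBomb`; cdisprove seat, cycle 1).  The crux quantifies over stationary
asymptotically flat black holes `𝓑 : StationaryAFBlackHole` with hypotheses: vacuum,
`I⁺`-regular, future-presented (`∀ p, p ∈ I⁺(M_ext)`), `T ≠ 0` on the d.o.c., simply connected
d.o.c., and — for an open `U ⊇ 𝓔⁺` and a vector field `K` — connectedness of `𝓔⁺`, `K` smooth and
Killing on `U`, `[T, K] = 0` on `U`, `K ≠ 0` and tangent on `𝓔⁺`, `K` timelike on `U ∩ doc`, and
the existence of a Killing extension `K'` of `K` to the d.o.c. commuting with `T`; it concludes that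
the d.o.c. is the image of an injective isometric immersion of a sub-extremal Kerr exterior chart.

**Main result** (`hawkingExtensionIsKerr_false_without_connectedHorizon`): the crux with the
single binder `IsConnected 𝓑.horizon →` DELETED (everything else verbatim) is FALSE — *any proof of
the crux must use the non-emptiness of the future event horizon*; none of `I⁺`-regularity,
future-presentedness, simple connectivity of the d.o.c., the collar clauses or the extension
clause supplies it.

**Witness**: the Minkowski presentation `minkowskiBH` of
`Theorems/ZeroEnergyRigidity/Negative/MinkowskiPresentation.lean` (`(ℝ⁴, η, ∂ₜ)`, slice `{t = 0}`,
trivial data, end `{‖y‖ > 1}`): `doc = ℝ⁴` (`doc_minkowskiBH`), `𝓔⁺ = ∅` (`horizon_minkowskiBH`),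
`I⁺`-regular (`isIPlusRegular_minkowskiBH`), vacuum (`h1_minkowskiBH`), `∂ₜ ≠ 0`
(`h5_minkowskiBH`), `I⁺(M_ext) = ℝ⁴` (`chronologicalFuture_Mext_eq_univ`), and `ℝ⁴` is simply
connected (contractible).  With `𝓔⁺ = ∅` the collar data may be taken VOID: `U := ∅`, `K := 0`
(every collar clause quantifies over `U`, `𝓔⁺` or `U ∩ doc`), and the extension clause is met by
`K' := ∂ₜ` with `U' := ∅` (`∂ₜ` is a smooth Killing field and `[∂ₜ, ∂ₜ] = 0`).  The conclusion
fails at `minkowskiBH` (`not_kerrConclusion_minkowskiBH`: a Kerr exterior isometric to `ℝ⁴` would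
make the Kerr–Schild chart `{r > 0}` a `C⁰`-extension of Minkowski spacetime, contradicting
Sbierski's inextendibility theorem, proved in the tree).

Also recorded (`hawkingExtensionIsKerr_iff_without_killingNonvanishing`): the hypothesis
`∀ p ∈ 𝓑.doc, 𝓑.killing p ≠ 0` is REDUNDANT — it follows from `𝓑.IsIPlusRegular` for every
presentation (Chruściel–Costa 2008, Cor. 3.8, `I⁺`-regular form, PROVED in the tree as
`StationaryAFBlackHole.IsIPlusRegular.killing_ne_zero_of_mem_doc`), so the crux is equivalent to
itself with that binder deleted.  For provers: `T ≠ 0` on the d.o.c. is free; for the planner: the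
binder is decoration (kept only for byte-identity with stmt-13896's telescope).

References: P. T. Chruściel, J. L. Costa, Astérisque 321 (2008), Def. 1.1, Lemma 3.7, Cor. 3.8,
Thm. 1.3; J. Sbierski, J. Differential Geom. 108 (2018), Thm. 1.
-/

noncomputable section

namespace Summit.FinalStateConjecture.FinalStateConjecture.Theorems.HawkingExtensionIsKerr.Negative

open Set Function Literature.Geometry.Lorentzian
open scoped Manifold ContDiff Topology
open Summit.FinalStateConjecture.FinalStateConjecture.Theorems.ZeroEnergyRigidity.Negative
open Summit.FinalStateConjecture.FinalStateConjecture.Theses.ZeroEnergyKerrOrBomb (HawkingExtensionIsKerr)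

/-! ## The remaining hypotheses at the Minkowski presentation -/

/-- The d.o.c. `ℝ⁴` of the Minkowski presentation is simply connected (a real normed space is
contractible). [folklore] -/
theorem simplyConnectedSpace_doc_minkowskiBH : SimplyConnectedSpace minkowskiBH.doc := by
  rw [doc_minkowskiBH]
  change SimplyConnectedSpace (univ : Set E4)
  exact (Homeomorph.Set.univ E4).toHomotopyEquiv.simplyConnectedSpace_iff.2 inferInstance

/-- The Minkowski presentation is future-presented: every event lies in `I⁺(M_ext) = ℝ⁴`. [folklore] -/
theorem futurePresented_minkowskiBH (p : minkowskiBH.carrier) :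
    p ∈ minkowskiBH.metric.chronologicalFuture minkowskiBH.timeOrientation minkowskiBH.Mext := by
  change p ∈ LorentzianMetric.chronologicalFuture
    (LorentzianMetric.ofLE (n' := (∞ : ℕ∞ω)) Minkowski.metric le_top)
    (TimeOrientation.ofLE (n' := (∞ : ℕ∞ω)) Minkowski.timeOrientation le_top) minkowskiBH.Mext
  rw [chronologicalFuture_Mext_eq_univ]
  exact mem_univ _

/-- The extension clause at the Minkowski presentation, met by `K' := ∂ₜ` and `U' := ∅`: `∂ₜ` is a
smooth Killing field on the d.o.c. commuting with itself. [folklore] -/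
theorem extension_minkowskiBH [minkowskiBH.metric.HasLeviCivita]
    (K : Π x : minkowskiBH.carrier, TangentSpace (𝓡 4) x) :
    ∃ K' : Π x : minkowskiBH.carrier, TangentSpace (𝓡 4) x,
      ContMDiffOn (𝓡 4) ((𝓡 4).prod 𝓘(ℝ, E4)) ((⊤ : ℕ∞) : WithTop ℕ∞)
        (fun x ↦ (Bundle.TotalSpace.mk' E4 x (K' x) : TangentBundle (𝓡 4) minkowskiBH.carrier))
        minkowskiBH.doc ∧
      (∀ x ∈ minkowskiBH.doc, ∀ v w : TangentSpace (𝓡 4) x,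
        minkowskiBH.metric.val x (minkowskiBH.metric.leviCivita K' x v) w +
          minkowskiBH.metric.val x v (minkowskiBH.metric.leviCivita K' x w) = 0) ∧
      (∀ x ∈ minkowskiBH.doc, VectorField.mlieBracket (𝓡 4) minkowskiBH.killing K' x = 0) ∧
      ∃ U' : Set minkowskiBH.carrier, IsOpen U' ∧ minkowskiBH.horizon ⊆ U' ∧
        ∀ x ∈ U' ∩ minkowskiBH.doc, K' x = K x := by
  have hK := minkowskiBH.isStationary.isKillingField
  refine ⟨minkowskiBH.killing, hK.contMDiff.contMDiffOn, fun x _ v w ↦ hK.val_leviCivita_add x v w,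
    fun x _ ↦ ?_, ∅, isOpen_empty, ?_, fun x hx ↦ hx.1.elim⟩
  · rw [VectorField.mlieBracket_self]
    rfl
  rw [horizon_minkowskiBH]

/-! ## The crux without `IsConnected 𝓑.horizon` is false -/

/-- **Any proof of `HawkingExtensionIsKerr` must use `IsConnected 𝓑.horizon`** (i.e. a NON-EMPTY
future event horizon): the crux (stmt-FinalStateConjecture-17840) with that single binder DELETED —
all other hypotheses and the conclusion verbatim — is FALSE.  Witness: the Minkowski presentation
`minkowskiBH` with the void collar `U := ∅`, `K := 0` and the extension `K' := ∂ₜ`, `U' := ∅`; its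
d.o.c. `ℝ⁴` is no sub-extremal Kerr exterior (Sbierski). [cite: SbierskiJDG2018, Thm. 1] -/
theorem hawkingExtensionIsKerr_false_without_connectedHorizon :
    ¬ ∀ (𝓑 : StationaryAFBlackHole.{0}) [𝓑.metric.HasLeviCivita] [Kerr.Facts],
      𝓑.metric.toPseudoRiemannianMetric.IsRicciFlat → 𝓑.IsIPlusRegular →
      (∀ p : 𝓑.carrier, p ∈ 𝓑.metric.chronologicalFuture 𝓑.timeOrientation 𝓑.Mext) →
      (∀ p ∈ 𝓑.doc, 𝓑.killing p ≠ 0) → SimplyConnectedSpace 𝓑.doc →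
      ∀ (U : Set 𝓑.carrier) (K : Π x : 𝓑.carrier, TangentSpace (𝓡 4) x), IsOpen U →
      𝓑.horizon ⊆ U →
      ContMDiffOn (𝓡 4) ((𝓡 4).prod 𝓘(ℝ, E4)) ((⊤ : ℕ∞) : WithTop ℕ∞)
        (fun x ↦ (Bundle.TotalSpace.mk' E4 x (K x) : TangentBundle (𝓡 4) 𝓑.carrier)) U →
      (∀ x ∈ U, ∀ v w : TangentSpace (𝓡 4) x, 𝓑.metric.val x (𝓑.metric.leviCivita K x v) w +
        𝓑.metric.val x v (𝓑.metric.leviCivita K x w) = 0) →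
      (∀ x ∈ U, VectorField.mlieBracket (𝓡 4) 𝓑.killing K x = 0) →
      (∀ p ∈ 𝓑.horizon, K p ≠ 0) →
      (∀ γ : ℝ → 𝓑.carrier, IsMIntegralCurve γ K → γ 0 ∈ 𝓑.horizon → ∀ t, γ t ∈ 𝓑.horizon) →
      (∀ x ∈ U ∩ 𝓑.doc, 𝓑.metric.val x (K x) (K x) < 0) →
      (∃ K' : Π x : 𝓑.carrier, TangentSpace (𝓡 4) x,
        ContMDiffOn (𝓡 4) ((𝓡 4).prod 𝓘(ℝ, E4)) ((⊤ : ℕ∞) : WithTop ℕ∞)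
          (fun x ↦ (Bundle.TotalSpace.mk' E4 x (K' x) : TangentBundle (𝓡 4) 𝓑.carrier)) 𝓑.doc ∧
        (∀ x ∈ 𝓑.doc, ∀ v w : TangentSpace (𝓡 4) x,
          𝓑.metric.val x (𝓑.metric.leviCivita K' x v) w +
            𝓑.metric.val x v (𝓑.metric.leviCivita K' x w) = 0) ∧
        (∀ x ∈ 𝓑.doc, VectorField.mlieBracket (𝓡 4) 𝓑.killing K' x = 0) ∧
        ∃ U' : Set 𝓑.carrier, IsOpen U' ∧ 𝓑.horizon ⊆ U' ∧ ∀ x ∈ U' ∩ 𝓑.doc, K' x = K x) →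
      ∃ (M a : ℝ), Kerr.IsSubextremal M a ∧ ∃ Ψ : Kerr.exterior M a → 𝓑.carrier,
        Function.Injective Ψ ∧ Set.range Ψ = 𝓑.doc ∧
          PseudoRiemannianMetric.IsIsometricImmersion
            (Kerr.smoothMetric M a (Kerr.rPlus M a)).toPseudoRiemannianMetric
            𝓑.metric.toPseudoRiemannianMetric Ψ := by
  intro h
  haveI : Kerr.Facts := kerrFacts
  haveI : minkowskiBH.metric.HasLeviCivita :=
    minkowskiBH.metric.toPseudoRiemannianMetric.hasLeviCivita
  refine not_kerrConclusion_minkowskiBH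
    (h minkowskiBH h1_minkowskiBH isIPlusRegular_minkowskiBH futurePresented_minkowskiBH
      h5_minkowskiBH simplyConnectedSpace_doc_minkowskiBH ∅ 0 isOpen_empty ?_
      (fun x hx ↦ hx.elim) (fun x hx ↦ hx.elim) (fun x hx ↦ hx.elim) ?_ ?_ (fun x hx ↦ hx.1.elim)
      (extension_minkowskiBH 0))
  · rw [horizon_minkowskiBH]
  · intro p hp
    rw [horizon_minkowskiBH] at hp
    exact hp.elim
  · intro γ _ h0
    rw [horizon_minkowskiBH] at h0
    exact h0.elim

/-- The same witness, positively: the hypotheses of the crux OTHER than `IsConnected 𝓑.horizon` are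
JOINTLY SATISFIABLE by a presentation with EMPTY future event horizon at which the conclusion
fails (so no restate may weaken connectedness to a clause implied by the others). [folklore] -/
theorem exists_presentation_empty_horizon_extension_not_kerr :
    ∃ (𝓑 : StationaryAFBlackHole.{0}) (_ : 𝓑.metric.HasLeviCivita) (_ : Kerr.Facts),
      𝓑.horizon = ∅ ∧ 𝓑.metric.toPseudoRiemannianMetric.IsRicciFlat ∧ 𝓑.IsIPlusRegular ∧
      (∀ p : 𝓑.carrier, p ∈ 𝓑.metric.chronologicalFuture 𝓑.timeOrientation 𝓑.Mext) ∧
      (∀ p ∈ 𝓑.doc, 𝓑.killing p ≠ 0) ∧ SimplyConnectedSpace 𝓑.doc ∧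
      ¬ ∃ (M a : ℝ), Kerr.IsSubextremal M a ∧ ∃ Ψ : Kerr.exterior M a → 𝓑.carrier,
        Function.Injective Ψ ∧ Set.range Ψ = 𝓑.doc ∧
          PseudoRiemannianMetric.IsIsometricImmersion
            (Kerr.smoothMetric M a (Kerr.rPlus M a)).toPseudoRiemannianMetric
            𝓑.metric.toPseudoRiemannianMetric Ψ := by
  haveI hK : Kerr.Facts := kerrFacts
  haveI hL : minkowskiBH.metric.HasLeviCivita :=
    minkowskiBH.metric.toPseudoRiemannianMetric.hasLeviCivita
  exact ⟨minkowskiBH, hL, hK, horizon_minkowskiBH, h1_minkowskiBH, isIPlusRegular_minkowskiBH,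
    futurePresented_minkowskiBH, h5_minkowskiBH, simplyConnectedSpace_doc_minkowskiBH,
    not_kerrConclusion_minkowskiBH⟩

/-! ## The hypothesis `T ≠ 0` on the d.o.c. is redundant -/

/-- **`HawkingExtensionIsKerr` is equivalent to itself with the binder
`(∀ p ∈ 𝓑.doc, 𝓑.killing p ≠ 0) →` deleted**: in an `I⁺`-regular black hole the stationary Killing
field has no zero in the d.o.c. (Chruściel–Costa 2008, Cor. 3.8, `I⁺`-regular form, tree theorem
`StationaryAFBlackHole.IsIPlusRegular.killing_ne_zero_of_mem_doc`).  The right-hand side is the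
served statement of stmt-FinalStateConjecture-17840 verbatim minus that binder. [cite: ChruscielCosta2008, Cor. 3.8] -/
theorem hawkingExtensionIsKerr_iff_without_killingNonvanishing :
    HawkingExtensionIsKerr ↔
      ∀ (𝓑 : StationaryAFBlackHole.{0}) [𝓑.metric.HasLeviCivita] [Kerr.Facts],
      𝓑.metric.toPseudoRiemannianMetric.IsRicciFlat → 𝓑.IsIPlusRegular →
      (∀ p : 𝓑.carrier, p ∈ 𝓑.metric.chronologicalFuture 𝓑.timeOrientation 𝓑.Mext) →
      SimplyConnectedSpace 𝓑.doc →
      ∀ (U : Set 𝓑.carrier) (K : Π x : 𝓑.carrier, TangentSpace (𝓡 4) x), IsOpen U →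
      𝓑.horizon ⊆ U → IsConnected 𝓑.horizon →
      ContMDiffOn (𝓡 4) ((𝓡 4).prod 𝓘(ℝ, E4)) ((⊤ : ℕ∞) : WithTop ℕ∞)
        (fun x ↦ (Bundle.TotalSpace.mk' E4 x (K x) : TangentBundle (𝓡 4) 𝓑.carrier)) U →
      (∀ x ∈ U, ∀ v w : TangentSpace (𝓡 4) x, 𝓑.metric.val x (𝓑.metric.leviCivita K x v) w +
        𝓑.metric.val x v (𝓑.metric.leviCivita K x w) = 0) →
      (∀ x ∈ U, VectorField.mlieBracket (𝓡 4) 𝓑.killing K x = 0) →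
      (∀ p ∈ 𝓑.horizon, K p ≠ 0) →
      (∀ γ : ℝ → 𝓑.carrier, IsMIntegralCurve γ K → γ 0 ∈ 𝓑.horizon → ∀ t, γ t ∈ 𝓑.horizon) →
      (∀ x ∈ U ∩ 𝓑.doc, 𝓑.metric.val x (K x) (K x) < 0) →
      (∃ K' : Π x : 𝓑.carrier, TangentSpace (𝓡 4) x,
        ContMDiffOn (𝓡 4) ((𝓡 4).prod 𝓘(ℝ, E4)) ((⊤ : ℕ∞) : WithTop ℕ∞)
          (fun x ↦ (Bundle.TotalSpace.mk' E4 x (K' x) : TangentBundle (𝓡 4) 𝓑.carrier)) 𝓑.doc ∧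
        (∀ x ∈ 𝓑.doc, ∀ v w : TangentSpace (𝓡 4) x,
          𝓑.metric.val x (𝓑.metric.leviCivita K' x v) w +
            𝓑.metric.val x v (𝓑.metric.leviCivita K' x w) = 0) ∧
        (∀ x ∈ 𝓑.doc, VectorField.mlieBracket (𝓡 4) 𝓑.killing K' x = 0) ∧
        ∃ U' : Set 𝓑.carrier, IsOpen U' ∧ 𝓑.horizon ⊆ U' ∧ ∀ x ∈ U' ∩ 𝓑.doc, K' x = K x) →
      ∃ (M a : ℝ), Kerr.IsSubextremal M a ∧ ∃ Ψ : Kerr.exterior M a → 𝓑.carrier,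
        Function.Injective Ψ ∧ Set.range Ψ = 𝓑.doc ∧
          PseudoRiemannianMetric.IsIsometricImmersion
            (Kerr.smoothMetric M a (Kerr.rPlus M a)).toPseudoRiemannianMetric
            𝓑.metric.toPseudoRiemannianMetric Ψ := by
  constructor
  · intro h 𝓑 _ _ hRic hreg hfut
    exact h 𝓑 hRic hreg hfut
      (fun p hp ↦ StationaryAFBlackHole.IsIPlusRegular.killing_ne_zero_of_mem_doc hreg hp)
  · intro h 𝓑 _ _ hRic hreg hfut _
    exact h 𝓑 hRic hreg hfut

end Summit.FinalStateConjecture.FinalStateConjecture.Theorems.HawkingExtensionIsKerr.Negative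

end
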